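import Literature.Computability.AlgebraicComplexity.Bur24UnboundedDegreeClassesF2
import Literature.Computability.Complexity.ParityClosure
import Literature.Computability.Complexity.CircuitEval
import Literature.Computability.Complexity.CircuitClassesProofs
import Literature.Computability.Complexity.CircuitClassesUniformProofs
import Literature.Computability.Complexity.TM2Iterate
import HarnessLib

/-!
# `VNPnb^{𝔽₂}` is `⊕P/poly` — the advice form (Bürgisser 2024 survey, Rem. 4.5, second sentence)

P. Bürgisser, *Completeness classes in algebraic complexity theory*, arXiv:2406.06217 (2024),
Remark 4.5 (p. 16, lines 17–18 of the held text): "`VNPnb^{𝔽₂}` is the nonuniform version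
`⊕P/poly` of parity polynomial time".  `Bur24UnboundedDegreeClassesF2.lean` proves the CIRCUIT form
`Bur24_rem_4_5_parity`: a language `L` is decided on `0/1` inputs by a `VNPnb^{𝔽₂}` family iff
membership is the parity of the number of accepting auxiliary inputs of a polynomial-size family of
`B₂`-circuits.  This file closes the gap to the tree's literal reading of `⊕P/poly`, namely
`polyAdvice ParityP` — the advice operator `polyAdvice` of `CircuitClasses.lean` (Arora–Barak,
Def. 6.16: `L ∈ 𝒞/poly` iff `x ∈ L ↔ ⟨x, a_{|x|}⟩ ∈ L'` for some `L' ∈ 𝒞` and advice strings `a_n` of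
polynomial length) applied to `⊕P = ParityP = pParity P` (`ParityQuantifier.lean`, Arora–Barak
Def. 17.15 / Papadimitriou–Zachos).

## Main statement

* `Bur24_rem_4_5_parity_advice (L) :
    (∃ f, IsVNPnbFamily f ∧ BoolDecides f L) ↔ L ∈ polyAdvice ParityP`.

## Proof (the standard `𝒞/poly = polynomial-size 𝒞-circuits` argument, run for `⊕P`)

* §1 `exists_parityCircuits_of_mem_polyAdvice_ParityP` (`(⊕P)/poly ⊆` circuit parities): for
  `L' = {z | #{y ∈ {0,1}^{q(|z|)} : ⟨z, y⟩ ∈ L₀} odd}` with `L₀ ∈ P ⊆ P/poly`, take the polynomial-size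
  circuits for `L₀` on pairs (`exists_cktSize_boolPair_of_mem_PPoly`), hard-wire the advice `a_n`
  (`cktSize_pairVec`, `CktSize.hardwire`) and keep the `u(n) = q(|⟨x, a_n⟩|)` witness bits as
  auxiliary inputs; the witness count is then literally the number of accepting auxiliary inputs.
* §2 `mem_polyAdvice_ParityP_of_parityCircuits` (circuit parities `⊆ (⊕P)/poly`): the advice for
  length `n` is `⟨desc C_n, 1^{u(n)}⟩`, where `desc` is the circuit code read by the tree's
  polynomial-time circuit evaluator (`CircEval.evalFn`, `CircEval.EvalLang_mem_P`,
  `CircEval.evalFn_boolPair_desc`; Arora–Barak Thm. 6.18); the `⊕P` language is obtained from the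
  `P` relation `{⟨⟨x, ⟨d, t⟩⟩, y⟩ | evalFn ⟨x·y, d⟩ = 1}` by the parity quantifier over `|t|` witness
  bits (`ParityClosure.paritySum_mem_ParityP`, `ParityClosure.P_subset_ParityP`).
* §3 assembles with `Bur24_rem_4_5_parity`.

No new definitions and no named facts: theorems only, over the vocabulary of
`Bur24UnboundedDegreeClassesF2.lean` (`IsVNPnbFamily`, `BoolDecides`), `CircuitClasses.lean`
(`polyAdvice`, `PPoly`, `Circuit`, `B2`), `ParityQuantifier.lean` (`ParityP`, `countWitnesses`).

## References

* [Burgisser2024Completeness] P. Bürgisser, Completeness classes in algebraic complexity theory,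
  arXiv:2406.06217, Rem. 4.5.
* [AroraBarak2009] S. Arora, B. Barak, Computational Complexity: A Modern Approach, CUP 2009,
  Def. 6.16 (advice classes), Thm. 6.18 (circuit evaluation), Def. 17.15 (`⊕P`).
-/

noncomputable section

open MvPolynomial

namespace Literature.Computability.AlgebraicComplexity

open Literature.Computability.Complexity
open CircuitArith (toK)

/-! ## §1. From advice to circuits: `(⊕P)/poly ⊆` parity of polynomial-size circuits -/

section AdviceToCircuits

/-- Counting over `{0,1}^m` as vectors or as functions. [folklore] -/
private theorem countWitnesses_eq_card_boolIndicator (R : Language Bool) (m : ℕ) (z : List Bool) :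
    countWitnesses R m z =
      (Finset.univ.filter fun e : Fin m → Bool =>
        R.boolIndicator (boolPair z (List.ofFn e)) = true).card := by
  classical
  unfold countWitnesses
  refine Finset.card_equiv (Equiv.vectorEquivFin Bool m) fun y => ?_
  simp only [Finset.mem_filter, Finset.mem_univ, true_and]
  have hy : List.ofFn ((Equiv.vectorEquivFin Bool m) y) = y.toList := by
    change List.ofFn y.get = y.toList
    rw [← List.Vector.toList_ofFn, List.Vector.ofFn_get]
  rw [hy]
  exact Set.mem_iff_boolIndicator _ _

/-- Polynomial arithmetic: evaluation of `2X + 2 + p`. [folklore] -/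
private theorem eval_two_X_add (p : Polynomial ℕ) (n : ℕ) :
    (2 * Polynomial.X + 2 + p : Polynomial ℕ).eval n = 2 * n + 2 + p.eval n := by
  simp [Polynomial.eval_add, Polynomial.eval_mul]

/-- **`(⊕P)/poly` languages are parities of polynomial-size circuits with auxiliary inputs**:
unfold the advice `a_n` and the `⊕P` witness relation `L₀ ∈ P ⊆ P/poly`, take the `B₂`-circuits
of `L₀` on pairs (`exists_cktSize_boolPair_of_mem_PPoly`), precompose with the pairing wiring of
`x` with the hard-wired advice (`cktSize_pairVec`, `CktSize.hardwire`).
[cite: Burgisser2024Completeness, Rem. 4.5 (p0016 L17–L18)] [cite: AroraBarak2009, Def. 6.16, Def. 17.15] -/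
theorem exists_parityCircuits_of_mem_polyAdvice_ParityP {L : Language Bool}
    (hL : L ∈ polyAdvice ParityP) :
    ∃ (u : ℕ → ℕ) (p : Polynomial ℕ) (C : ∀ n, Circuit (Fin n ⊕ Fin (u n))),
      (∀ n, (C n).IsOver B2 ∧ (C n).size ≤ p.eval n ∧ u n ≤ p.eval n) ∧
      ∀ x : List Bool, x ∈ L ↔ Odd (Finset.univ.filter fun e : Fin (u x.length) → Bool =>
        (C x.length).eval (Sum.elim x.get e) = true).card := by
  obtain ⟨L', hL'P, a, pa, ha, hxL⟩ := hL
  obtain ⟨L₀, hL₀, q, hL'⟩ := hL'P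
  obtain ⟨qc, hqc⟩ := exists_cktSize_boolPair_of_mem_PPoly (P_subset_PPoly_holds hL₀)
  -- input lengths: `N n = |⟨x, a_n⟩|`, witness length `u n = q(N n)`
  let N : ℕ → ℕ := fun n => 2 * n + 2 + (a n).length
  let u : ℕ → ℕ := fun n => q.eval (N n)
  -- the circuits
  have main : ∀ n : ℕ, ∃ D : Circuit (Fin n ⊕ Fin (u n)), D.IsOver B2 ∧
      D.size ≤ N n + 0 + (2 * N n + 2 + u n + qc.eval (2 * N n + 2 + u n)) + 2 ∧
      ∀ w : Fin n ⊕ Fin (u n) → Bool, D.eval w =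
        L₀.boolIndicator (boolPair (boolPair (List.ofFn fun i => w (.inl i)) (a n))
          (List.ofFn fun j => w (.inr j))) := by
    intro n
    -- stage A: `(x, y, a') ↦ (pairVec x a', y)`
    have hA : CktSize B2 (fun (w : (Fin n ⊕ Fin (u n)) ⊕ Fin (a n).length → Bool) =>
        Sum.elim (pairVec (fun i => w (.inl (.inl i))) (fun j => w (.inr j)))
          (fun j => w (.inl (.inr j)))) (N n + 0) :=
      ((cktSize_pairVec n (a n).length).rewire
        (Sum.elim (fun i => Sum.inl (Sum.inl i)) fun j => Sum.inr j)).pair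
        (CktSize.proj B2 fun j => Sum.inl (Sum.inr j))
    -- stage B: the circuits of `L₀` on pairs, composed, advice hard-wired
    obtain ⟨D, hDB, hDs, hDe⟩ := ((hA.comp (hqc (N n) (u n))).hardwire (a n).get).toCircuit
    refine ⟨D, hDB, hDs, fun w => ?_⟩
    rw [hDe w]
    show L₀.boolIndicator (boolPair (List.ofFn (pairVec (fun i => w (.inl i)) (a n).get))
      (List.ofFn fun j => w (.inr j))) = _
    rw [ofFn_pairVec, List.ofFn_get]
  choose C hCB hCs hCe using main
  -- polynomial bounds
  let Np : Polynomial ℕ := 2 * Polynomial.X + 2 + pa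
  let M : Polynomial ℕ := 2 * Np + 2 + q.comp Np
  have hNp : ∀ n, N n ≤ Np.eval n := fun n => by
    simp only [Np, eval_two_X_add, N]; exact Nat.add_le_add_left (ha n) _
  have hu : ∀ n, u n ≤ (q.comp Np).eval n := fun n => by
    rw [Polynomial.eval_comp]; exact TM2Iter.eval_mono q (hNp n)
  have hM : ∀ n, 2 * N n + 2 + u n ≤ M.eval n := fun n => by
    have h1 := hNp n; have h2 := hu n
    simp only [M, Polynomial.eval_add, Polynomial.eval_mul, Polynomial.eval_ofNat]
    omega
  have hqcM : ∀ n, qc.eval (2 * N n + 2 + u n) ≤ (qc.comp M).eval n := fun n => by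
    rw [Polynomial.eval_comp]; exact TM2Iter.eval_mono qc (hM n)
  refine ⟨u, Np + M + qc.comp M + 2 + q.comp Np, C, fun n => ⟨hCB n, ?_, ?_⟩, fun x => ?_⟩
  · have h1 := hNp n; have h2 := hM n; have h3 := hqcM n
    refine (hCs n).trans ?_
    simp only [Polynomial.eval_add, Polynomial.eval_ofNat]
    omega
  · have h2 := hu n
    simp only [Polynomial.eval_add, Polynomial.eval_ofNat]
    omega
  · rw [hxL x, hL', length_boolPair, countWitnesses_eq_card_boolIndicator]
    refine iff_of_eq (congrArg Odd (congrArg Finset.card (Finset.filter_congr fun e _ => ?_)))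
    rw [hCe]
    show _ ↔ L₀.boolIndicator (boolPair (boolPair (List.ofFn x.get) (a x.length)) (List.ofFn e)) = true
    rw [List.ofFn_get]

end AdviceToCircuits

/-! ## §2. From circuits to advice: parity of polynomial-size circuits `⊆ (⊕P)/poly`

Given polynomial-size `B₂`-circuits `C_n` on `n + u(n)` inputs, the advice for length `n` is
`a_n = ⟨desc C_n, 1^{u(n)}⟩` (`CircEval.desc`: the code of the circuit for the tree's polynomial-time
circuit evaluator `CircEval.evalFn`), the `⊕P` language is
`L' = {v | #{y ∈ {0,1}^{|t|} : ⟨v, y⟩ ∈ L₀} odd}` for `v = ⟨x, ⟨d, t⟩⟩`, with the witness relation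
`L₀ = {⟨⟨x, ⟨d, t⟩⟩, y⟩ | evalFn ⟨x·y, d⟩ = 1} ∈ P` (`CircEval.EvalLang_mem_P` and the `FP` bricks),
`L' ∈ ⊕P` by the tree's `ParityClosure.paritySum_mem_ParityP`. -/

section CircuitsToAdvice

/-- The witness-checking map `⟨⟨x, ⟨d, t⟩⟩, y⟩ ↦ ⟨x·y, d⟩` (input and witness concatenated, paired
with the circuit code) is in `FP`, with its value on well-formed inputs. [folklore] -/
private theorem exists_witMap :
    ∃ g : List Bool → List Bool, g ∈ FP ∧ ∀ x d t y : List Bool,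
      g (boolPair (boolPair x (boolPair d t)) y) = boolPair (x ++ y) d :=
  ⟨fanoutFn (OracleCompose.concatFn ∘ fanoutFn (Brick.fstF ∘ Brick.fstF) Brick.sndF)
      (Brick.fstF ∘ Brick.sndF ∘ Brick.fstF),
    fanoutFn_mem_FP (comp_mem_FP OracleCompose.concatFn_mem_FP
        (fanoutFn_mem_FP (comp_mem_FP Brick.fstF_mem_FP Brick.fstF_mem_FP) Brick.sndF_mem_FP))
      (comp_mem_FP Brick.fstF_mem_FP (comp_mem_FP Brick.sndF_mem_FP Brick.fstF_mem_FP)),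
    fun x d t y => by simp⟩

/-- The witness-length selector `⟨x, ⟨d, t⟩⟩ ↦ t` is in `FP`. [folklore] -/
private theorem exists_lenMap :
    ∃ g : List Bool → List Bool, g ∈ FP ∧ ∀ x d t : List Bool,
      g (boolPair x (boolPair d t)) = t :=
  ⟨Brick.sndF ∘ Brick.sndF, comp_mem_FP Brick.sndF_mem_FP Brick.sndF_mem_FP, fun x d t => by simp⟩

/-- The circuit evaluator on an input list of the right length (transport of
`CircEval.evalFn_boolPair_desc` along `|w| = m`). [folklore] -/
private theorem evalFn_boolPair_desc_of_length {m : ℕ} (C : Circuit (Fin m)) (hC : C.IsOver B2)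
    (w : List Bool) (hw : w.length = m) :
    CircEval.evalFn (boolPair w (CircEval.desc C)) =
      [C.eval fun i => w.get (Fin.cast hw.symm i)] := by
  subst hw
  exact CircEval.evalFn_boolPair_desc w C fun g hg => hC g hg

/-- Polynomial arithmetic for the advice length. [folklore] -/
private theorem advice_length_le {n u s D : ℕ} {p : Polynomial ℕ} (hs : s ≤ p.eval n)
    (hu : u ≤ p.eval n) (hD : D ≤ (s + 1) * (8 * (n + u + s) + 10)) :
    2 * D + 2 + u ≤ (2 * ((p + 1) * (8 * (Polynomial.X + p + p) + 10)) + 2 + p : Polynomial ℕ).eval n := by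
  simp only [Polynomial.eval_add, Polynomial.eval_mul, Polynomial.eval_ofNat, Polynomial.eval_one,
    Polynomial.eval_X]
  have h1 : (s + 1) * (8 * (n + u + s) + 10) ≤ (p.eval n + 1) * (8 * (n + p.eval n + p.eval n) + 10) :=
    Nat.mul_le_mul (by omega) (by omega)
  omega

/-- **Parities of polynomial-size circuits with auxiliary inputs are in `(⊕P)/poly`.**
[cite: Burgisser2024Completeness, Rem. 4.5 (p0016 L17–L18)] [cite: AroraBarak2009, Def. 6.16, Def. 17.15, Thm. 6.18] -/
theorem mem_polyAdvice_ParityP_of_parityCircuits {L : Language Bool} {u : ℕ → ℕ}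
    {p : Polynomial ℕ} (C : ∀ n, Circuit (Fin n ⊕ Fin (u n)))
    (hC : ∀ n, (C n).IsOver B2 ∧ (C n).size ≤ p.eval n ∧ u n ≤ p.eval n)
    (hL : ∀ x : List Bool, x ∈ L ↔ Odd (Finset.univ.filter fun e : Fin (u x.length) → Bool =>
      (C x.length).eval (Sum.elim x.get e) = true).card) :
    L ∈ polyAdvice ParityP := by
  -- flatten the inputs `Fin n ⊕ Fin (u n)` to `Fin (n + u n)`
  have hflat : ∀ n, ∃ D : Circuit (Fin (n + u n)), D.IsOver B2 ∧ D.size ≤ (C n).size ∧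
      ∀ v : Fin (n + u n) → Bool, D.eval v = (C n).eval fun i => v (finSumFinEquiv i) :=
    fun n => (((C n).cktSize_eval (hC n).1).rewire
      (⇑(finSumFinEquiv : Fin n ⊕ Fin (u n) ≃ Fin (n + u n)))).toCircuit
  choose D hDB hDs hDe using hflat
  obtain ⟨wit, hwit, wit_apply⟩ := exists_witMap
  obtain ⟨len, hlen, len_apply⟩ := exists_lenMap
  -- advice, witness relation, parity language
  let adv : ℕ → List Bool := fun n => boolPair (CircEval.desc (D n)) (List.replicate (u n) true)
  let L₀ : Language Bool := wit ⁻¹' CircEval.EvalLang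
  have hL₀ : L₀ ∈ Classes.P := preimage_mem_P CircEval.EvalLang_mem_P hwit
  let L' : Language Bool := {v | Odd (countWitnesses L₀ (len v).length v)}
  have hL' : L' ∈ ParityP :=
    ParityClosure.paritySum_mem_ParityP (ParityClosure.P_subset_ParityP hL₀) hlen
  refine ⟨L', hL', adv, 2 * ((p + 1) * (8 * (Polynomial.X + p + p) + 10)) + 2 + p, fun n => ?_,
    fun x => ?_⟩
  · -- advice length
    show (boolPair (CircEval.desc (D n)) (List.replicate (u n) true)).length ≤ _
    rw [length_boolPair, List.length_replicate]
    exact advice_length_le (hC n).2.1 (hC n).2.2 ((CircEval.length_desc_le (D n)).trans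
      (Nat.mul_le_mul (by have := hDs n; omega) (by have := hDs n; omega)))
  · -- membership
    rw [hL x]
    show _ ↔ Odd (countWitnesses L₀ (len (boolPair x (adv x.length))).length
      (boolPair x (adv x.length)))
    rw [len_apply, List.length_replicate, countWitnesses_eq_card_boolIndicator]
    refine iff_of_eq (congrArg Odd (congrArg Finset.card (Finset.filter_congr fun e _ => ?_)))
    -- one witness `e`: the circuit `D` on `x·e` computes `C(x, e)`
    rw [← Set.mem_iff_boolIndicator]
    show _ ↔ wit (boolPair (boolPair x (boolPair (CircEval.desc (D x.length))
      (List.replicate (u x.length) true))) (List.ofFn e)) ∈ CircEval.EvalLang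
    rw [wit_apply]
    have hw : (x ++ List.ofFn e).length = x.length + u x.length := by simp
    show _ ↔ CircEval.evalFn _ = [true]
    rw [evalFn_boolPair_desc_of_length (D x.length) (hDB _) _ hw, List.cons.injEq, hDe]
    simp only [and_true]
    have hfun : (fun i => (x ++ List.ofFn e).get (Fin.cast hw.symm (finSumFinEquiv i))) =
        Sum.elim x.get e := by
      funext i
      rcases i with i | j
      · simp [List.getElem_append_left]
      · simp [List.getElem_append_right]
    rw [hfun]

end CircuitsToAdvice

/-! ## §3. Remark 4.5, second sentence, advice form -/

/-- **Bürgisser 2024, Rem. 4.5 (second sentence): "`VNPnb^{𝔽₂}` is the nonuniform version `⊕P/poly`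
of parity polynomial time"** — advice form: a language is decided on `0/1` inputs by a
`VNPnb^{𝔽₂}` family (`IsVNPnbFamily`, `BoolDecides` of `Bur24UnboundedDegreeClassesF2.lean`) iff it
lies in `(⊕P)/poly` — the tree's advice operator `polyAdvice` (`CircuitClasses.lean`, Arora–Barak
Def. 6.16) applied to `⊕P = pParity P` (`ParityQuantifier.lean`, Arora–Barak Def. 17.15). Proof:
the circuit form `Bur24_rem_4_5_parity` and §1–§2.
[cite: Burgisser2024Completeness, Rem. 4.5 (p0016 L17–L18)] -/
theorem Bur24_rem_4_5_parity_advice (L : Language Bool) :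
    (∃ f : ∀ n, MvPolynomial (Fin n) (ZMod 2), IsVNPnbFamily f ∧ BoolDecides f L) ↔
      L ∈ polyAdvice ParityP :=
  (Bur24_rem_4_5_parity L).trans
    ⟨fun ⟨_, _, C, hC, hL⟩ => mem_polyAdvice_ParityP_of_parityCircuits C hC hL,
      exists_parityCircuits_of_mem_polyAdvice_ParityP⟩

end Literature.Computability.AlgebraicComplexity

end
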